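import Summits.Parity.GeneralizedHardyLittlewood.Theorems.FordMaynardNoSieveConst0164NegWitness0164SectionMomentsPeel

/-!
# Route `FordMaynardNoSieveConst0164`, crux `NegWitness0164` (stmt-Parity-19102), line `birth`,
# stub `stub_tweakNeg0164`: enclosure layer — section moments of the unit box, inner closed forms and outer ranges

Helper file toward the certificate stub (K. Ford, J. Maynard, *On the theory of prime producing sieves*,
arXiv:2407.14368, §8).  Continuing `…SectionMomentsPeel`: the inner moments
`N_{ab}(r) = ∫_{(0,r)} 𝟙[0<x<1, 0<r−x<1] x^a (r−x)^b dx` in closed form on `(0,1]` and `[1,2]` (`a, b ≤ 2`), and the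
three generic OUTER range lemmas turning `∫_{(0,s]} 𝟙[0<t<1] t^c N(s−t) dt` into interval integrals of
`t^c·P(s−t)` with the polynomial representatives `P` of `N` on each range (`s ∈ (0,1]`, `[1,2]`, `[2,3]`).  With
`sectionMoment_peel_0164` this leaves, for each section moment `M_{abc}` and range, one polynomial interval integral
(the antiderivative pattern of `…SectionMomentsInner`), whose values are the 27 × 3 exact polynomials listed in this
hand's census on stmt-Parity-19102.

* `innerMoment_low_a_b_0164`, `innerMoment_high_a_b_0164` (`a, b ≤ 2`);
* `outer_range_one_0164`, `outer_range_two_0164`, `outer_range_three_0164`.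

Def-free.  References: [FordMaynard2024PrimeSieves] arXiv:2407.14368, §8 (proof of Theorem 2.7 (c)); folklore calculus.
-/

noncomputable section

open Finset MeasureTheory Set intervalIntegral
open scoped Classical
open Literature.NumberTheory.Sieve Literature.NumberTheory.Sieve.FordMaynard

namespace Summit.Parity.GeneralizedHardyLittlewood.FordMaynardNoSieveConst0164NegWitness0164

/-! ### Inner closed forms -/

/-- `N_{00}(r)` for `0 < r ≤ 1`. [folklore] -/
theorem innerMoment_low_0_0_0164 {r : ℝ} (hr0 : 0 < r) (hr1 : r ≤ 1) :
    (∫ x in Set.Ioo 0 r, (if (0 < x ∧ x < 1) ∧ (0 < r - x ∧ r - x < 1) then x ^ 0 else 0)) =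
      (1 : ℝ) * r := by
  rw [inner_window_low_0164 hr0 hr1 (fun x : ℝ => x ^ 0), integral_pow_mul_sub_pow_0_0_0164 0 r]
  ring

/-- `N_{00}(r)` for `1 ≤ r ≤ 2`. [folklore] -/
theorem innerMoment_high_0_0_0164 {r : ℝ} (hr1 : 1 ≤ r) (hr2 : r ≤ 2) :
    (∫ x in Set.Ioo 0 r, (if (0 < x ∧ x < 1) ∧ (0 < r - x ∧ r - x < 1) then x ^ 0 else 0)) =
      (2 : ℝ) + (-1 : ℝ) * r := by
  rw [inner_window_high_0164 hr1 hr2 (fun x : ℝ => x ^ 0), integral_pow_mul_sub_pow_0_0_0164 (r - 1) 1]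
  ring

/-- `N_{01}(r)` for `0 < r ≤ 1`. [folklore] -/
theorem innerMoment_low_0_1_0164 {r : ℝ} (hr0 : 0 < r) (hr1 : r ≤ 1) :
    (∫ x in Set.Ioo 0 r, (if (0 < x ∧ x < 1) ∧ (0 < r - x ∧ r - x < 1) then (r - x) else 0)) =
      (1 / 2 : ℝ) * r ^ 2 := by
  rw [inner_window_low_0164 hr0 hr1 (fun x : ℝ => (r - x)), integral_pow_mul_sub_pow_0_1_0164 r 0 r]
  ring

/-- `N_{01}(r)` for `1 ≤ r ≤ 2`. [folklore] -/
theorem innerMoment_high_0_1_0164 {r : ℝ} (hr1 : 1 ≤ r) (hr2 : r ≤ 2) :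
    (∫ x in Set.Ioo 0 r, (if (0 < x ∧ x < 1) ∧ (0 < r - x ∧ r - x < 1) then (r - x) else 0)) =
      (1 : ℝ) * r + (-(1 / 2) : ℝ) * r ^ 2 := by
  rw [inner_window_high_0164 hr1 hr2 (fun x : ℝ => (r - x)), integral_pow_mul_sub_pow_0_1_0164 r (r - 1) 1]
  ring

/-- `N_{02}(r)` for `0 < r ≤ 1`. [folklore] -/
theorem innerMoment_low_0_2_0164 {r : ℝ} (hr0 : 0 < r) (hr1 : r ≤ 1) :
    (∫ x in Set.Ioo 0 r, (if (0 < x ∧ x < 1) ∧ (0 < r - x ∧ r - x < 1) then (r - x) ^ 2 else 0)) =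
      (1 / 3 : ℝ) * r ^ 3 := by
  rw [inner_window_low_0164 hr0 hr1 (fun x : ℝ => (r - x) ^ 2), integral_pow_mul_sub_pow_0_2_0164 r 0 r]
  ring

/-- `N_{02}(r)` for `1 ≤ r ≤ 2`. [folklore] -/
theorem innerMoment_high_0_2_0164 {r : ℝ} (hr1 : 1 ≤ r) (hr2 : r ≤ 2) :
    (∫ x in Set.Ioo 0 r, (if (0 < x ∧ x < 1) ∧ (0 < r - x ∧ r - x < 1) then (r - x) ^ 2 else 0)) =
      (2 / 3 : ℝ) + (-1 : ℝ) * r + (1 : ℝ) * r ^ 2 + (-(1 / 3) : ℝ) * r ^ 3 := by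
  rw [inner_window_high_0164 hr1 hr2 (fun x : ℝ => (r - x) ^ 2), integral_pow_mul_sub_pow_0_2_0164 r (r - 1) 1]
  ring

/-- `N_{10}(r)` for `0 < r ≤ 1`. [folklore] -/
theorem innerMoment_low_1_0_0164 {r : ℝ} (hr0 : 0 < r) (hr1 : r ≤ 1) :
    (∫ x in Set.Ioo 0 r, (if (0 < x ∧ x < 1) ∧ (0 < r - x ∧ r - x < 1) then x else 0)) =
      (1 / 2 : ℝ) * r ^ 2 := by
  rw [inner_window_low_0164 hr0 hr1 (fun x : ℝ => x), integral_pow_mul_sub_pow_1_0_0164 0 r]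
  ring

/-- `N_{10}(r)` for `1 ≤ r ≤ 2`. [folklore] -/
theorem innerMoment_high_1_0_0164 {r : ℝ} (hr1 : 1 ≤ r) (hr2 : r ≤ 2) :
    (∫ x in Set.Ioo 0 r, (if (0 < x ∧ x < 1) ∧ (0 < r - x ∧ r - x < 1) then x else 0)) =
      (1 : ℝ) * r + (-(1 / 2) : ℝ) * r ^ 2 := by
  rw [inner_window_high_0164 hr1 hr2 (fun x : ℝ => x), integral_pow_mul_sub_pow_1_0_0164 (r - 1) 1]
  ring

/-- `N_{11}(r)` for `0 < r ≤ 1`. [folklore] -/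
theorem innerMoment_low_1_1_0164 {r : ℝ} (hr0 : 0 < r) (hr1 : r ≤ 1) :
    (∫ x in Set.Ioo 0 r, (if (0 < x ∧ x < 1) ∧ (0 < r - x ∧ r - x < 1) then x * (r - x) else 0)) =
      (1 / 6 : ℝ) * r ^ 3 := by
  rw [inner_window_low_0164 hr0 hr1 (fun x : ℝ => x * (r - x)), integral_pow_mul_sub_pow_1_1_0164 r 0 r]
  ring

/-- `N_{11}(r)` for `1 ≤ r ≤ 2`. [folklore] -/
theorem innerMoment_high_1_1_0164 {r : ℝ} (hr1 : 1 ≤ r) (hr2 : r ≤ 2) :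
    (∫ x in Set.Ioo 0 r, (if (0 < x ∧ x < 1) ∧ (0 < r - x ∧ r - x < 1) then x * (r - x) else 0)) =
      (-(2 / 3) : ℝ) + (1 : ℝ) * r + (-(1 / 6) : ℝ) * r ^ 3 := by
  rw [inner_window_high_0164 hr1 hr2 (fun x : ℝ => x * (r - x)), integral_pow_mul_sub_pow_1_1_0164 r (r - 1) 1]
  ring

/-- `N_{12}(r)` for `0 < r ≤ 1`. [folklore] -/
theorem innerMoment_low_1_2_0164 {r : ℝ} (hr0 : 0 < r) (hr1 : r ≤ 1) :
    (∫ x in Set.Ioo 0 r, (if (0 < x ∧ x < 1) ∧ (0 < r - x ∧ r - x < 1) then x * (r - x) ^ 2 else 0)) =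
      (1 / 12 : ℝ) * r ^ 4 := by
  rw [inner_window_low_0164 hr0 hr1 (fun x : ℝ => x * (r - x) ^ 2), integral_pow_mul_sub_pow_1_2_0164 r 0 r]
  ring

/-- `N_{12}(r)` for `1 ≤ r ≤ 2`. [folklore] -/
theorem innerMoment_high_1_2_0164 {r : ℝ} (hr1 : 1 ≤ r) (hr2 : r ≤ 2) :
    (∫ x in Set.Ioo 0 r, (if (0 < x ∧ x < 1) ∧ (0 < r - x ∧ r - x < 1) then x * (r - x) ^ 2 else 0)) =
      (-(1 / 3) : ℝ) * r + (1 / 2 : ℝ) * r ^ 2 + (-(1 / 12) : ℝ) * r ^ 4 := by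
  rw [inner_window_high_0164 hr1 hr2 (fun x : ℝ => x * (r - x) ^ 2), integral_pow_mul_sub_pow_1_2_0164 r (r - 1) 1]
  ring

/-- `N_{20}(r)` for `0 < r ≤ 1`. [folklore] -/
theorem innerMoment_low_2_0_0164 {r : ℝ} (hr0 : 0 < r) (hr1 : r ≤ 1) :
    (∫ x in Set.Ioo 0 r, (if (0 < x ∧ x < 1) ∧ (0 < r - x ∧ r - x < 1) then x ^ 2 else 0)) =
      (1 / 3 : ℝ) * r ^ 3 := by
  rw [inner_window_low_0164 hr0 hr1 (fun x : ℝ => x ^ 2), integral_pow_mul_sub_pow_2_0_0164 0 r]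
  ring

/-- `N_{20}(r)` for `1 ≤ r ≤ 2`. [folklore] -/
theorem innerMoment_high_2_0_0164 {r : ℝ} (hr1 : 1 ≤ r) (hr2 : r ≤ 2) :
    (∫ x in Set.Ioo 0 r, (if (0 < x ∧ x < 1) ∧ (0 < r - x ∧ r - x < 1) then x ^ 2 else 0)) =
      (2 / 3 : ℝ) + (-1 : ℝ) * r + (1 : ℝ) * r ^ 2 + (-(1 / 3) : ℝ) * r ^ 3 := by
  rw [inner_window_high_0164 hr1 hr2 (fun x : ℝ => x ^ 2), integral_pow_mul_sub_pow_2_0_0164 (r - 1) 1]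
  ring

/-- `N_{21}(r)` for `0 < r ≤ 1`. [folklore] -/
theorem innerMoment_low_2_1_0164 {r : ℝ} (hr0 : 0 < r) (hr1 : r ≤ 1) :
    (∫ x in Set.Ioo 0 r, (if (0 < x ∧ x < 1) ∧ (0 < r - x ∧ r - x < 1) then x ^ 2 * (r - x) else 0)) =
      (1 / 12 : ℝ) * r ^ 4 := by
  rw [inner_window_low_0164 hr0 hr1 (fun x : ℝ => x ^ 2 * (r - x)), integral_pow_mul_sub_pow_2_1_0164 r 0 r]
  ring

/-- `N_{21}(r)` for `1 ≤ r ≤ 2`. [folklore] -/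
theorem innerMoment_high_2_1_0164 {r : ℝ} (hr1 : 1 ≤ r) (hr2 : r ≤ 2) :
    (∫ x in Set.Ioo 0 r, (if (0 < x ∧ x < 1) ∧ (0 < r - x ∧ r - x < 1) then x ^ 2 * (r - x) else 0)) =
      (-(1 / 3) : ℝ) * r + (1 / 2 : ℝ) * r ^ 2 + (-(1 / 12) : ℝ) * r ^ 4 := by
  rw [inner_window_high_0164 hr1 hr2 (fun x : ℝ => x ^ 2 * (r - x)), integral_pow_mul_sub_pow_2_1_0164 r (r - 1) 1]
  ring

/-- `N_{22}(r)` for `0 < r ≤ 1`. [folklore] -/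
theorem innerMoment_low_2_2_0164 {r : ℝ} (hr0 : 0 < r) (hr1 : r ≤ 1) :
    (∫ x in Set.Ioo 0 r, (if (0 < x ∧ x < 1) ∧ (0 < r - x ∧ r - x < 1) then x ^ 2 * (r - x) ^ 2 else 0)) =
      (1 / 30 : ℝ) * r ^ 5 := by
  rw [inner_window_low_0164 hr0 hr1 (fun x : ℝ => x ^ 2 * (r - x) ^ 2), integral_pow_mul_sub_pow_2_2_0164 r 0 r]
  ring

/-- `N_{22}(r)` for `1 ≤ r ≤ 2`. [folklore] -/
theorem innerMoment_high_2_2_0164 {r : ℝ} (hr1 : 1 ≤ r) (hr2 : r ≤ 2) :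
    (∫ x in Set.Ioo 0 r, (if (0 < x ∧ x < 1) ∧ (0 < r - x ∧ r - x < 1) then x ^ 2 * (r - x) ^ 2 else 0)) =
      (2 / 5 : ℝ) + (-1 : ℝ) * r + (2 / 3 : ℝ) * r ^ 2 + (-(1 / 30) : ℝ) * r ^ 5 := by
  rw [inner_window_high_0164 hr1 hr2 (fun x : ℝ => x ^ 2 * (r - x) ^ 2), integral_pow_mul_sub_pow_2_2_0164 r (r - 1) 1]
  ring

/-! ### Outer ranges -/

/-- **Outer range `s ∈ (0,1]`**: `∫_{(0,s]} 𝟙[0<t<1] t^c N(s−t) = ∫_0^s t^c P(s−t)` if `N = P` on `(0,1]`. [folklore] -/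
theorem outer_range_one_0164 (c : ℕ) {s : ℝ} (hs0 : 0 < s) (hs1 : s ≤ 1) (N P : ℝ → ℝ)
    (hN : ∀ r, 0 < r → r ≤ 1 → N r = P r) :
    (∫ t in Set.Ioc 0 s, (if 0 < t ∧ t < 1 then t ^ c * N (s - t) else 0)) = ∫ t in (0 : ℝ)..s, t ^ c * P (s - t) := by
  rw [integral_Ioc_eq_integral_Ioo, setIntegral_congr_fun measurableSet_Ioo (g := fun t => t ^ c * P (s - t))
    (fun t ht => by
      show (if 0 < t ∧ t < 1 then t ^ c * N (s - t) else 0) = t ^ c * P (s - t)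
      rw [if_pos ⟨ht.1, lt_of_lt_of_le ht.2 hs1⟩, hN (s - t) (by linarith [ht.2]) (by linarith [ht.1])]),
    ← integral_Ioc_eq_integral_Ioo, ← intervalIntegral.integral_of_le hs0.le]

/-- **Outer range `s ∈ [1,2)`**: the `t`-range `(0,1)` splits at `t = s − 1` into the high and the low inner
regime: `∫_{(0,s]} 𝟙[0<t<1] t^c N(s−t) = ∫_0^{s−1} t^c Q(s−t) + ∫_{s−1}^1 t^c P(s−t)`. [folklore] -/
theorem outer_range_two_0164 (c : ℕ) {s : ℝ} (hs1 : 1 ≤ s) (hs2 : s < 2) (N P Q : ℝ → ℝ)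
    (hN1 : ∀ r, 0 < r → r ≤ 1 → N r = P r) (hN2 : ∀ r, 1 ≤ r → r ≤ 2 → N r = Q r)
    (hP : Continuous P) (hQ : Continuous Q) :
    (∫ t in Set.Ioc 0 s, (if 0 < t ∧ t < 1 then t ^ c * N (s - t) else 0)) =
      (∫ t in (0 : ℝ)..(s - 1), t ^ c * Q (s - t)) + ∫ t in (s - 1 : ℝ)..1, t ^ c * P (s - t) := by
  have h1 : (∫ t in Set.Ioc 0 s, (if 0 < t ∧ t < 1 then t ^ c * N (s - t) else 0)) =
      ∫ t in Set.Ioo 0 1, t ^ c * N (s - t) := by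
    rw [setIntegral_congr_fun measurableSet_Ioc (g := (Set.Ioo (0 : ℝ) 1).indicator fun t => t ^ c * N (s - t))
      (fun t _ => by
        show (if 0 < t ∧ t < 1 then t ^ c * N (s - t) else 0) = (Set.Ioo (0 : ℝ) 1).indicator (fun t => t ^ c * N (s - t)) t
        by_cases h : 0 < t ∧ t < 1
        · rw [if_pos h, Set.indicator_of_mem (show t ∈ Set.Ioo (0 : ℝ) 1 from h)]
        · rw [if_neg h, Set.indicator_of_notMem (show t ∉ Set.Ioo (0 : ℝ) 1 from h)]),
      setIntegral_indicator measurableSet_Ioo,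
      show Set.Ioc (0 : ℝ) s ∩ Set.Ioo 0 1 = Set.Ioo 0 1 from Set.inter_eq_right.2 fun t ht => ⟨ht.1, by linarith [ht.2]⟩]
  rw [h1]
  have hsplit : Set.Ioo (0 : ℝ) 1 = Set.Ioc 0 (s - 1) ∪ Set.Ioo (s - 1) 1 := by
    ext t
    simp only [Set.mem_Ioo, Set.mem_union, Set.mem_Ioc]
    constructor
    · intro h
      by_cases ht : t ≤ s - 1
      · exact Or.inl ⟨h.1, ht⟩
      · exact Or.inr ⟨lt_of_not_ge ht, h.2⟩
    · rintro (h | h)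
      · exact ⟨h.1, by linarith [h.2]⟩
      · exact ⟨by linarith [h.1], h.2⟩
  have hdisj : Disjoint (Set.Ioc (0 : ℝ) (s - 1)) (Set.Ioo (s - 1) 1) := by
    rw [Set.disjoint_left]
    intro t ht ht'
    linarith [ht.2, ht'.1]
  have hQeq : EqOn (fun t : ℝ => t ^ c * Q (s - t)) (fun t => t ^ c * N (s - t)) (Set.Ioc (0 : ℝ) (s - 1)) :=
    fun t ht => by
      show t ^ c * Q (s - t) = t ^ c * N (s - t)
      rw [hN2 (s - t) (by linarith [ht.2]) (by linarith [ht.1])]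
  have hPeq : EqOn (fun t : ℝ => t ^ c * P (s - t)) (fun t => t ^ c * N (s - t)) (Set.Ioo (s - 1 : ℝ) 1) :=
    fun t ht => by
      show t ^ c * P (s - t) = t ^ c * N (s - t)
      rw [hN1 (s - t) (by linarith [ht.2]) (by linarith [ht.1])]
  have hQint : IntegrableOn (fun t : ℝ => t ^ c * N (s - t)) (Set.Ioc (0 : ℝ) (s - 1)) := by
    have : IntegrableOn (fun t : ℝ => t ^ c * Q (s - t)) (Set.Ioc (0 : ℝ) (s - 1)) :=
      ((by fun_prop : Continuous fun t : ℝ => t ^ c * Q (s - t)).integrableOn_Icc).mono_set Ioc_subset_Icc_self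
    exact this.congr_fun hQeq measurableSet_Ioc
  have hPint : IntegrableOn (fun t : ℝ => t ^ c * N (s - t)) (Set.Ioo (s - 1 : ℝ) 1) := by
    have : IntegrableOn (fun t : ℝ => t ^ c * P (s - t)) (Set.Ioo (s - 1 : ℝ) 1) :=
      ((by fun_prop : Continuous fun t : ℝ => t ^ c * P (s - t)).integrableOn_Icc).mono_set Ioo_subset_Icc_self
    exact this.congr_fun hPeq measurableSet_Ioo
  rw [hsplit, setIntegral_union hdisj measurableSet_Ioo hQint hPint]
  congr 1
  · rw [← setIntegral_congr_fun measurableSet_Ioc hQeq, ← intervalIntegral.integral_of_le (by linarith)]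
  · rw [← setIntegral_congr_fun measurableSet_Ioo hPeq, ← integral_Ioc_eq_integral_Ioo,
      ← intervalIntegral.integral_of_le (by linarith)]

/-- **Outer range `s ∈ [2,3]`**: only `t ∈ (s−2, 1)` contributes, in the high inner regime:
`∫_{(0,s]} 𝟙[0<t<1] t^c N(s−t) = ∫_{s−2}^1 t^c Q(s−t)`. [folklore] -/
theorem outer_range_three_0164 (c : ℕ) {s : ℝ} (hs2 : 2 ≤ s) (hs3 : s ≤ 3) (N Q : ℝ → ℝ)
    (hN2 : ∀ r, 1 ≤ r → r ≤ 2 → N r = Q r) (hN0 : ∀ r, 2 ≤ r → N r = 0) :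
    (∫ t in Set.Ioc 0 s, (if 0 < t ∧ t < 1 then t ^ c * N (s - t) else 0)) =
      ∫ t in (s - 2 : ℝ)..1, t ^ c * Q (s - t) := by
  rw [setIntegral_congr_fun measurableSet_Ioc (g := (Set.Ioo (s - 2 : ℝ) 1).indicator fun t => t ^ c * Q (s - t))
    (fun t ht => by
      show (if 0 < t ∧ t < 1 then t ^ c * N (s - t) else 0) = (Set.Ioo (s - 2 : ℝ) 1).indicator (fun t => t ^ c * Q (s - t)) t
      by_cases h : t ∈ Set.Ioo (s - 2 : ℝ) 1
      · rw [Set.indicator_of_mem h, if_pos ⟨ht.1, h.2⟩, hN2 (s - t) (by linarith [h.2]) (by linarith [h.1])]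
      · rw [Set.indicator_of_notMem h]
        by_cases h' : 0 < t ∧ t < 1
        · rw [if_pos h']
          have hge : 2 ≤ s - t := by
            by_contra hc
            push Not at hc
            exact h ⟨by linarith, h'.2⟩
          rw [hN0 (s - t) hge, mul_zero]
        · rw [if_neg h']),
    setIntegral_indicator measurableSet_Ioo,
    show Set.Ioc (0 : ℝ) s ∩ Set.Ioo (s - 2) 1 = Set.Ioo (s - 2) 1 from
      Set.inter_eq_right.2 fun t ht => ⟨by linarith [ht.1], by linarith [ht.2]⟩,
    ← integral_Ioc_eq_integral_Ioo, ← intervalIntegral.integral_of_le (by linarith)]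

end Summit.Parity.GeneralizedHardyLittlewood.FordMaynardNoSieveConst0164NegWitness0164

end
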